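import Summits.MatrixMultiplication.MatrixMultiplication.Theorems.SaturationLadderCatalyticTransfer
import HarnessLib

/-!
# Route `SaturationLadder` — CATALYTIC TRANSFER II: «a catalyst is a defect `log⁺(s/t)/log q`», the gauge cone closed under
catalytic transfers, onset rigidity with catalysts (decomp-mm lens 1 «grading / quantitative ladder», gen 30; route-free helper)

Continuation of `…SaturationLadderCatalyticTransfer` (same certificate `⟨s⟩ ⊗ ⟨p^{a'},p^{b'},p^{c'}⟩^{⊠N} ⊵ ⟨t⟩ ⊗ ⟨q^a,q^b,q^c⟩`,
exact in the sense `U_cat ≤ a + c`).  §1: the CLLZ regime `s ≤ t` (at least as many target copies returned as catalyst copies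
borrowed) obeys BOTH exact laws `b·a' ≤ a·b'`, `b·c' ≤ c·b'` with no threshold.  §2: the dictionary asked for by critic g29 r3 —
a base-side catalyst is a DEFECT of size `d := log⁺(s/t)/log q` in the precise sense that the catalytic laws imply gen 28's
defect-form laws `2b·a' ≤ 2a·b' + d·(a'+b')`, `2b·c' ≤ 2c·b' + d·(b'+c')`.  §3: every gauge class `G_{λ,μ}` (`λ ≥ 0`, gen 29) is
closed under catalytic transfers below the integrality thresholds (`gauge_catalytic_transfer`; every `s ≤ t` qualifies), so the
two-sided saturation constant `c₂` of the tree's certificate catalogue (gen 29 `treeClasses_constant`) is unchanged by base-side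
catalysts — the in-class account of the crux `SubexpSaturation` (stmt-25909) is closed INCLUDING catalysts.  §4: the onset
rigidity of gen 27 survives small catalysts: an inner-square target `⟨q^a,q^b,q^b⟩` forces an inner-square far-tight base, and a
far target `⟨q^{jb},q^b,q^b⟩` is exactly certified only by bases that already give `E_j` by padding.
Support module beneath stmt-MatrixMultiplication-25909; closes no item; 0 sorry; no definitions; imports only BUILT modules.
[cite: ChristandlLeGallLysikovZuiddam2020, §1.3.3, Thm. 3.11 and Lemma 4.1; CoppersmithWinograd1990, §8 (pp. 268–269);
LottiRomani1983, §1 (p. 173); HuangPan1998, §2]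
-/

set_option linter.dupNamespace false

noncomputable section

open scoped BigOperators

namespace Summit.MatrixMultiplication.MatrixMultiplication.Theorems.SaturationLadderCatalyticTransferCone

open Literature.Computability.AlgebraicComplexity
open Literature.Barriers.MatrixMultiplication
open Summit.MatrixMultiplication.MatrixMultiplication.Theorems.SaturationLadderTransferLawRigidity
  (far_of_innerSquare_tight)  -- landed, imported
open Summit.MatrixMultiplication.MatrixMultiplication.Theorems.SaturationLadderGaugeCone
  (gauge_transfer)  -- landed, imported
open Summit.MatrixMultiplication.MatrixMultiplication.Theorems.SaturationLadderCatalyticTransfer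
  (catalytic_skeleton catalytic_base_tight catalytic_thinness_law catalytic_length_law
    thinness_law_of_smallCatalyst length_law_of_smallCatalyst)  -- part I, imported

variable {K : Type} [Field K]

section Catalytic

variable {p a' b' c' N s t q a b c : ℕ} (hp : 2 ≤ p) (hq : 2 ≤ q) (hs : 1 ≤ s) (ht : 1 ≤ t)
  (h : PolyDegeneratesTo
    (kroneckerTensor (unitTensor K s) (kroneckerPow (matMulTensor K (p ^ a') (p ^ b') (p ^ c')) N))
    (kroneckerTensor (unitTensor K t) (matMulTensor K (q ^ a) (q ^ b) (q ^ c))))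
  (hU : ((N : ℝ) * (omegaRect K a' b' c' * Real.log p) + Real.log s - Real.log t) / Real.log q ≤
    ((a + c : ℕ) : ℝ))
include hp hq hs ht h hU

/-! ## 1. The regime `s ≤ t` -/

/-- **The CLLZ regime `s ≤ t` obeys BOTH exact laws with no threshold**: when the certificate returns at least as many
target copies as it borrows catalyst copies (`σ ≤ 0`), `b·a' ≤ a·b'` and `b·c' ≤ c·b'` (`b' ≤ a'`, `b' ≤ c'`; automatic for
`N ≥ 1`). [cite: ChristandlLeGallLysikovZuiddam2020, §1.3.3 and Thm. 3.11] -/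
theorem laws_of_catalyst_le (hst : s ≤ t) (hba' : b' ≤ a') (hbc' : b' ≤ c') :
    b * a' ≤ a * b' ∧ b * c' ≤ c * b' := by
  obtain ⟨hL, -, -, -, -, -, -, -⟩ := catalytic_skeleton hp hq hs ht h hU
  have hs0 : (0 : ℝ) < s := by exact_mod_cast (by omega : 0 < s)
  have hstR : (s : ℝ) ≤ t := by exact_mod_cast hst
  have hσ : Real.log s - Real.log t ≤ 0 := by linarith [Real.log_le_log hs0 hstR]
  have hba'R : (b' : ℝ) ≤ a' := by exact_mod_cast hba'
  have hbc'R : (b' : ℝ) ≤ c' := by exact_mod_cast hbc'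
  have h₂ : ((a' : ℝ) - b') * (Real.log s - Real.log t) < 2 * Real.log q := by
    have : ((a' : ℝ) - b') * (Real.log s - Real.log t) ≤ 0 := mul_nonpos_of_nonneg_of_nonpos (by linarith) hσ
    linarith
  have h₃ : ((c' : ℝ) - b') * (Real.log s - Real.log t) < 2 * Real.log q := by
    have : ((c' : ℝ) - b') * (Real.log s - Real.log t) ≤ 0 := mul_nonpos_of_nonneg_of_nonpos (by linarith) hσ
    linarith
  exact ⟨thinness_law_of_smallCatalyst hp hq hs ht h hU hba' h₂,
    length_law_of_smallCatalyst hp hq hs ht h hU hbc' h₃⟩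

/-! ## 2. «A catalyst is a defect `log⁺(s/t)/log q`» -/

/-- **«A CATALYST IS A DEFECT» — thinness**: the catalytic law implies the defect-form thinness law of gen 28
(`…TransferLawDefect.defect_thinness_law`: `2b·a' ≤ 2a·b' + d·(a'+b')`) with `d := log⁺(s/t)/log q = max(log s − log t, 0)/log q`
(`b' ≤ a'`). [cite: ChristandlLeGallLysikovZuiddam2020, Thm. 3.11] -/
theorem catalyst_as_defect_thinness (hba' : b' ≤ a') :
    2 * (b : ℝ) * a' ≤
      2 * (a : ℝ) * b' + (max (Real.log s - Real.log t) 0 / Real.log q) * ((a' : ℝ) + b') := by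
  obtain ⟨hL, -, -, -, -, -, -, -⟩ := catalytic_skeleton hp hq hs ht h hU
  have hlaw := catalytic_thinness_law hp hq hs ht h hU hba'
  have hba'R : (b' : ℝ) ≤ a' := by exact_mod_cast hba'
  have hb'0 : (0 : ℝ) ≤ b' := Nat.cast_nonneg b'
  have hm0 : 0 ≤ max (Real.log s - Real.log t) 0 := le_max_right _ _
  have hm1 : Real.log s - Real.log t ≤ max (Real.log s - Real.log t) 0 := le_max_left _ _
  -- `(a'−b')·σ ≤ (a'−b')·σ⁺ ≤ (a'+b')·σ⁺`
  have k1 : ((a' : ℝ) - b') * (Real.log s - Real.log t) ≤ ((a' : ℝ) + b') * max (Real.log s - Real.log t) 0 := by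
    have k0 : ((a' : ℝ) - b') * (Real.log s - Real.log t) ≤ ((a' : ℝ) - b') * max (Real.log s - Real.log t) 0 :=
      mul_le_mul_of_nonneg_left hm1 (by linarith)
    nlinarith
  have k3 : (2 * (b : ℝ) * a' - 2 * (a : ℝ) * b') * Real.log q ≤
      max (Real.log s - Real.log t) 0 * ((a' : ℝ) + b') := by nlinarith
  have k4 : 2 * (b : ℝ) * a' - 2 * (a : ℝ) * b' ≤
      max (Real.log s - Real.log t) 0 * ((a' : ℝ) + b') / Real.log q := by
    rw [le_div_iff₀ hL]; exact k3
  have e : max (Real.log s - Real.log t) 0 * ((a' : ℝ) + b') / Real.log q =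
      (max (Real.log s - Real.log t) 0 / Real.log q) * ((a' : ℝ) + b') := by ring
  linarith [k4, e]

/-- **«A CATALYST IS A DEFECT» — length**: the catalytic law implies gen 28's defect-form length law
`2b·c' ≤ 2c·b' + d·(b'+c')` with `d := max(log s − log t, 0)/log q` (`b' ≤ c'`). [cite: ChristandlLeGallLysikovZuiddam2020, Thm. 3.11] -/
theorem catalyst_as_defect_length (hbc' : b' ≤ c') :
    2 * (b : ℝ) * c' ≤
      2 * (c : ℝ) * b' + (max (Real.log s - Real.log t) 0 / Real.log q) * ((b' : ℝ) + c') := by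
  obtain ⟨hL, -, -, -, -, -, -, -⟩ := catalytic_skeleton hp hq hs ht h hU
  have hlaw := catalytic_length_law hp hq hs ht h hU hbc'
  have hbc'R : (b' : ℝ) ≤ c' := by exact_mod_cast hbc'
  have hb'0 : (0 : ℝ) ≤ b' := Nat.cast_nonneg b'
  have hm0 : 0 ≤ max (Real.log s - Real.log t) 0 := le_max_right _ _
  have hm1 : Real.log s - Real.log t ≤ max (Real.log s - Real.log t) 0 := le_max_left _ _
  have k1 : ((c' : ℝ) - b') * (Real.log s - Real.log t) ≤ ((b' : ℝ) + c') * max (Real.log s - Real.log t) 0 := by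
    have k0 : ((c' : ℝ) - b') * (Real.log s - Real.log t) ≤ ((c' : ℝ) - b') * max (Real.log s - Real.log t) 0 :=
      mul_le_mul_of_nonneg_left hm1 (by linarith)
    nlinarith
  have k3 : (2 * (b : ℝ) * c' - 2 * (c : ℝ) * b') * Real.log q ≤
      max (Real.log s - Real.log t) 0 * ((b' : ℝ) + c') := by nlinarith
  have k4 : 2 * (b : ℝ) * c' - 2 * (c : ℝ) * b' ≤
      max (Real.log s - Real.log t) 0 * ((b' : ℝ) + c') / Real.log q := by
    rw [le_div_iff₀ hL]; exact k3
  have e : max (Real.log s - Real.log t) 0 * ((b' : ℝ) + c') / Real.log q =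
      (max (Real.log s - Real.log t) 0 / Real.log q) * ((b' : ℝ) + c') := by ring
  linarith [k4, e]

/-! ## 3. The gauge cone is closed under catalytic transfers -/

/-- **Every gauge class `G_{λ,μ}` (`λ ≥ 0`) is closed under catalytic transfers below the thresholds**: a base
`(a',b',c') ∈ G_{λ,μ}` with `1 ≤ b' < a'`, `b' ≤ c'` and an exact catalytic certificate with
`(a'−b')σ < 2·log q`, `(c'−b')σ < 2·log q` (`σ = log s − log t`; every `s ≤ t` qualifies) put the target `(a,b,c)` (`b ≥ 1`) in
`G_{λ,μ}` — so base-side catalysts change no slope: the two-sided saturation constant of the tree's certificate classes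
(gen 29 `treeClasses_constant`) is catalyst-proof. [cite: ChristandlLeGallLysikovZuiddam2020, Thm. 3.11 and Lemma 4.1;
CoppersmithWinograd1990, §8] -/
theorem gauge_catalytic_transfer {lam μ : ℝ} (hlam : 0 ≤ lam) (hb : 1 ≤ b) (hb' : 1 ≤ b') (hab' : b' < a')
    (hbc' : b' ≤ c')
    (hσ₂ : ((a' : ℝ) - b') * (Real.log s - Real.log t) < 2 * Real.log q)
    (hσ₃ : ((c' : ℝ) - b') * (Real.log s - Real.log t) < 2 * Real.log q)
    (hfloor : lam * ((b' : ℝ) / ((a' : ℝ) - b')) ≤ Real.log (((a' : ℝ) + c') / b') + μ) :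
    b < a ∧ lam * ((b : ℝ) / ((a : ℝ) - b)) ≤ Real.log (((a : ℝ) + c) / b) + μ :=
  gauge_transfer hlam hb hb' hab'
    (thinness_law_of_smallCatalyst hp hq hs ht h hU hab'.le hσ₂)
    (length_law_of_smallCatalyst hp hq hs ht h hU hbc' hσ₃) hfloor

/-- **… in particular under every catalytic transfer with `s ≤ t`.** [cite: ChristandlLeGallLysikovZuiddam2020, §1.3.3 and Thm. 3.11] -/
theorem gauge_transfer_of_catalyst_le {lam μ : ℝ} (hlam : 0 ≤ lam) (hst : s ≤ t) (hb : 1 ≤ b) (hb' : 1 ≤ b')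
    (hab' : b' < a') (hbc' : b' ≤ c')
    (hfloor : lam * ((b' : ℝ) / ((a' : ℝ) - b')) ≤ Real.log (((a' : ℝ) + c') / b') + μ) :
    b < a ∧ lam * ((b : ℝ) / ((a : ℝ) - b)) ≤ Real.log (((a : ℝ) + c) / b) + μ := by
  obtain ⟨hthin, hlen⟩ := laws_of_catalyst_le hp hq hs ht h hU hst hab'.le hbc'
  exact gauge_transfer hlam hb hb' hab' hthin hlen hfloor

/-! ## 4. Onset rigidity survives small catalysts -/

/-- **Inner-square targets have inner-square, far-tight bases — with catalysts** (`N, b ≥ 1`, thresholds as in §4):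
an exact catalytic certificate for `⟨q^a,q^b,q^b⟩` forces `c' = b'`, `b·a' ≤ a·b'` and `ω(a',b',b') = a'+b'`.
[cite: ChristandlLeGallLysikovZuiddam2020, Thm. 3.11 and Lemma 4.1; LottiRomani1983, §1 (p. 173)] -/
theorem catalytic_innerSquareTarget (hN : 1 ≤ N) (hb : 1 ≤ b) (hcb : c = b)
    (hσ₂ : ((a' : ℝ) - b') * (Real.log s - Real.log t) < 2 * Real.log q)
    (hσ₃ : ((c' : ℝ) - b') * (Real.log s - Real.log t) < 2 * Real.log q) :
    c' = b' ∧ b * a' ≤ a * b' ∧ omegaRect K a' b' b' = ((a' + b' : ℕ) : ℝ) := by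
  obtain ⟨hT, hba', hbc'⟩ := catalytic_base_tight hp hq hs ht h hU hN
  have hlen := length_law_of_smallCatalyst hp hq hs ht h hU hbc' hσ₃
  have hthin := thinness_law_of_smallCatalyst hp hq hs ht h hU hba' hσ₂
  have hlen' : b * c' ≤ b * b' := by rw [hcb] at hlen; exact hlen
  have hcb' : c' ≤ b' := Nat.le_of_mul_le_mul_left hlen' (by omega)
  have hc : c' = b' := le_antisymm hcb' hbc'
  subst hc
  exact ⟨rfl, hthin, hT⟩

/-- **Exact catalytic far-format certificates are REDUNDANT**: whatever format base exactly certifies — with a catalyst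
below the thresholds — the far format `⟨q^{jb},q^b,q^b⟩` (`N, b, b' ≥ 1`) already proves `E_j`, `ω(j,1,1) = j+1`, by padding.
Small catalysts move the engine along the far edge only UPWARD in the grade, exactly as without them (gen 27
`exact_farTarget_redundant`). [cite: LottiRomani1983, §1 (p. 173); ChristandlLeGallLysikovZuiddam2020, Thm. 3.11] -/
theorem catalytic_farTarget_redundant {j : ℕ} (hN : 1 ≤ N) (hb : 1 ≤ b) (hb' : 1 ≤ b') (hcb : c = b)
    (haj : a = j * b)
    (hσ₂ : ((a' : ℝ) - b') * (Real.log s - Real.log t) < 2 * Real.log q)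
    (hσ₃ : ((c' : ℝ) - b') * (Real.log s - Real.log t) < 2 * Real.log q) :
    omegaRect K j 1 1 = (j : ℝ) + 1 := by
  obtain ⟨hc', hthin, hT⟩ := catalytic_innerSquareTarget hp hq hs ht h hU hN hb hcb hσ₂ hσ₃
  subst haj
  refine far_of_innerSquare_tight (K := K) hb' ?_ hT
  have : b * a' ≤ b * (j * b') := by rw [← Nat.mul_assoc]; simpa [Nat.mul_comm] using hthin
  exact Nat.le_of_mul_le_mul_left this (by omega)

end Catalytic

end Summit.MatrixMultiplication.MatrixMultiplication.Theorems.SaturationLadderCatalyticTransferCone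

end
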